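import Mathlib
import HarnessLib.Audit
import Summits.PneNP.PneNP.Theorems.PstarChordBridgeForest
import Summits.PneNP.PneNP.Theorems.PstarChordBridgeLift

/-!
# Single-chord cores: abstract and actual (M0) witnesses at the forest edges (ROUND-24, memo §11 (N2); target `TerminalFiveA` / `…MaxSharing`)

FRONTIER range-avoidance ladder, rung F-N3, ROUND 24 (cell `pnp-ideate`, planner memo `r24/CORE-BOUND-NOTES.md` §11 (N2) "MINIMAL in `j ∈ J₀` ⟺
feasible after replacing `𝒞(G)` by `𝒞(G − j)`"; typed targets `PstarCoreBoundTargets.TerminalFiveA` / `TerminalFiveMaxSharing` (p646951);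
restricted-model proof complexity — nothing here bears on `P` versus `NP`).

For bridge data with a SINGLE chord `N = {e₀}` whose readers avoid the privates of `e₀` (the situation on a sheet of a fresh gate,
`PstarFreshGateSheet`), minimality in a FOREST edge `f ∈ D e₀` has an exact ABSTRACT form and, conversely, every abstract witness is realised:

* `val_single` — the model value with one chord: `val {e₀} x s = F x + p ρ_{e₀}(x) + p' ρ'_{e₀}(x)`;
* `forest_witness` — an actual solution of `(J₀ − f) ∧ Γ₁ ∧ Γ₂` read at `x = bit ∘ z`, states `(p, p')`: `p p' = u_{e₀}(x) + 1` and
  `val = t + ([f ∈ T₁], [f ∈ T₂])` (`PstarChordBridgeForest.forest_minimality` + `defect_eq_one`);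
* `peelable_insert_erase` — a cycle minus any edge is a forest: `D` peelable, `D + e₀` everywhere even ⇒ `(D + e₀) − f` peelable;
* `exists_solution_erase` — **realisation**: any base point `x` and states `(s₁, s₂)` with `s₁ s₂ = u_{e₀}(x) + 1` and
  `F x + s₁ ρ_{e₀} + s₂ ρ'_{e₀} = t + ([f ∈ T₁], [f ∈ T₂])` yield an actual solution of `(J₀ − f) ∧ Γ₁ ∧ Γ₂` (exchange `f ↔ e₀`: the exchanged
  data have no chord and a peelable forest, so `PstarChordBridge.infeasible_of_not_solution` applies; `PstarChordBridgeForest.free_exchange`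
  computes their state-free parts);
* `uval_takes_both` — the prescribed product of a chord takes both values (killable and forced base points exist).
-/

set_option linter.dupNamespace false -- `Summit.PneNP.PneNP.…`: summit = sub-problem name (D-0017 single-conjunct layout)

open Finset Literature.Computability.Complexity
open scoped symmDiff
open Summit.PneNP.PneNP.Theorems.PstarFibrePolys (bit bit_xor bit_and bit_injective)
open Summit.PneNP.PneNP.Theorems.PstarTyped (Typed)
open Summit.PneNP.PneNP.Theorems.PstarSALevel (varSet bdry BoundaryExpanding SimpleOverlap)
open Summit.PneNP.PneNP.Theorems.PstarCentreFree (vars_mem_varSet)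
open Summit.PneNP.PneNP.Theorems.PstarGapOneAll (gval)
open Summit.PneNP.PneNP.Theorems.PstarXCore (xverts xpair)
open Summit.PneNP.PneNP.Theorems.PstarReadSumset (V2)
open Summit.PneNP.PneNP.Theorems.PstarChordSystem (ChordSystem)
open Summit.PneNP.PneNP.Theorems.PstarChordBridgeTools
open Summit.PneNP.PneNP.Theorems.PstarChordBridge
open Summit.PneNP.PneNP.Theorems.PstarChordBridgeCotree (Peelable even_of_leafless_insert)
open Summit.PneNP.PneNP.Theorems.PstarChordBridgeExchange (exchange exchange_wf solution_exchange even_xpdeg_symmDiff)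
open Summit.PneNP.PneNP.Theorems.PstarChordBridgeForest (free_exchange forest_minimality defect_eq_one)
open Summit.PneNP.PneNP.Theorems.PstarChordBridgeLift (lift_of_wf_peelable)

namespace Summit.PneNP.PneNP.Theorems.PstarFreshGateRealise

variable {n m : ℕ}

/-- Every element of `𝔽₂` is `0` or `1`. -/
private theorem zmod2_cases (t : ZMod 2) : t = 0 ∨ t = 1 := by
  revert t; decide

/-! ## The model with one chord -/

/-- **The model value with a single chord.** -/
theorem val_single (S : ChordSystem (Fin m) (Fin n → ZMod 2)) (e₀ : Fin m) (x : Fin n → ZMod 2) (s : Fin m → ZMod 2 × ZMod 2) :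
    S.val {e₀} x s = S.F x + ((s e₀).1 • S.ρ e₀ x + (s e₀).2 • S.ρ' e₀ x) := by
  unfold ChordSystem.val ChordSystem.contrib
  rw [sum_singleton]

/-- The readers avoid both privates of `e₀` (4-conjunct form used by `forest_minimality` / `free_exchange`). -/
def AvoidsPrivs (I : LocalMap 4 n m) (G : Finset (Fin m)) (e₀ : Fin m) : Prop :=
  ∀ g ∈ G, I.vars g 2 ≠ I.vars e₀ 2 ∧ I.vars g 2 ≠ I.vars e₀ 3 ∧ I.vars g 3 ≠ I.vars e₀ 2 ∧ I.vars g 3 ≠ I.vars e₀ 3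

/-- With a single chord, `AvoidsPrivs` is the landed hypothesis `hun` restricted to one constraint. -/
theorem avoidsPrivs_of_hun (I : LocalMap 4 n m) {B : BridgeData n m} {e₀ : Fin m} (hN : B.N = {e₀}) {G : Finset (Fin m)}
    (hun : ∀ v ∈ privs I B.N, ∀ g ∈ G, I.vars g 2 ≠ v ∧ I.vars g 3 ≠ v) : AvoidsPrivs I G e₀ := by
  have he₀ : e₀ ∈ B.N := by rw [hN]; exact mem_singleton_self _
  intro g hg
  have h2 := hun _ (vars_mem_privs I he₀ (s := 2) (by decide)) g hg
  have h3 := hun _ (vars_mem_privs I he₀ (s := 3) (by decide)) g hg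
  exact ⟨h2.1, h3.1, h2.2, h3.2⟩

/-- The read vectors of the chord when no reader touches its privates: `([p ∈ C₁], [p ∈ C₂])`, `([p' ∈ C₁], [p' ∈ C₂])`. -/
theorem reads_of_avoids (I : LocalMap 4 n m) {B : BridgeData n m} {e₀ : Fin m} (he₀ : e₀ ∈ B.N) (h₁ : AvoidsPrivs I B.G₁ e₀)
    (h₂ : AvoidsPrivs I B.G₂ e₀) (x : Fin n → ZMod 2) :
    (sys I B).ρ e₀ x = ((if I.vars e₀ 2 ∈ B.C₁ then 1 else 0, if I.vars e₀ 2 ∈ B.C₂ then 1 else 0) : V2) ∧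
    (sys I B).ρ' e₀ x = ((if I.vars e₀ 3 ∈ B.C₁ then 1 else 0, if I.vars e₀ 3 ∈ B.C₂ then 1 else 0) : V2) := by
  rw [sys_ρ I B he₀, sys_ρ' I B he₀,
    PstarChordBridgeForcing.coef_of_unread I (fun g hg => ⟨(h₁ g hg).1, (h₁ g hg).2.2.1⟩),
    PstarChordBridgeForcing.coef_of_unread I (fun g hg => ⟨(h₂ g hg).1, (h₂ g hg).2.2.1⟩),
    PstarChordBridgeForcing.coef_of_unread I (fun g hg => ⟨(h₁ g hg).2.1, (h₁ g hg).2.2.2⟩),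
    PstarChordBridgeForcing.coef_of_unread I (fun g hg => ⟨(h₂ g hg).2.1, (h₂ g hg).2.2.2⟩)]
  exact ⟨rfl, rfl⟩

/-! ## Actual forest-edge witnesses, abstractly -/

/-- **An (M0) witness at a forest edge, read in the model** (`N = {e₀}`, readers off the privates of `e₀`, (T3) unsolvable): the states
violate the cycle (`p p' = u_{e₀} + 1`) and the constraint values are `t + ([f ∈ T₁], [f ∈ T₂])`. -/
theorem forest_witness (I : LocalMap 4 n m) (hI : I.IsPure xorAndPred) (hT : Typed I) {B : BridgeData n m} (hW : B.WF I) {e₀ : Fin m}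
    (hN : B.N = {e₀}) (h₁ : AvoidsPrivs I B.G₁ e₀) (h₂ : AvoidsPrivs I B.G₂ e₀) {f : Fin m} (hf : f ∈ B.D e₀)
    (hT3 : ¬ ∃ z, Solution I B B.J₀ z) {z : Fin n → Bool} (hz : Solution I B (B.J₀.erase f) z) :
    bit (z (I.vars e₀ 2)) * bit (z (I.vars e₀ 3)) = (sys I B).u e₀ (fun v => bit (z v)) + 1 ∧
    (sys I B).F (fun v => bit (z v)) + (bit (z (I.vars e₀ 2)) • (sys I B).ρ e₀ (fun v => bit (z v)) +
        bit (z (I.vars e₀ 3)) • (sys I B).ρ' e₀ (fun v => bit (z v))) =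
      (sys I B).t + ((if f ∈ B.T₁ then 1 else 0, if f ∈ B.T₂ then 1 else 0) : V2) := by
  have he₀ : e₀ ∈ B.N := by rw [hN]; exact mem_singleton_self _
  have hδ := defect_eq_one I hI hW he₀ hf hT3 hz
  obtain ⟨-, hval⟩ := forest_minimality I hI hT hW he₀ hf h₁ h₂ hz
  refine ⟨?_, ?_⟩
  · have e2 : ∀ a b : ZMod 2, a + b = 1 → b = a + 1 := by decide
    exact e2 _ _ hδ
  · rw [hN, val_single] at hval
    rw [hval, hδ]

/-! ## Realising abstract witnesses -/

/-- **A cycle minus an edge is a forest**: `D` peelable, `e₀ ∉ D`, `D + e₀` everywhere even ⇒ `(D + e₀) − f` peelable for every `f ∈ D + e₀`. -/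
theorem peelable_insert_erase (I : LocalMap 4 n m) (hI : I.IsPure xorAndPred) {D : Finset (Fin m)} (hP : Peelable I D) {e₀ : Fin m}
    (heD : e₀ ∉ D) (hev : ∀ w, Even (xpdeg I (insert e₀ D) w)) {f : Fin m} (hf : f ∈ insert e₀ D) :
    Peelable I ((insert e₀ D).erase f) := by
  classical
  intro S hS hne
  by_contra hno
  push Not at hno
  have hSC : S ⊆ insert e₀ D := hS.trans (erase_subset _ _)
  have hSev : ∀ w, Even (xpdeg I S w) := even_of_leafless_insert I hI hP hSC hne hno
  by_cases he : e₀ ∈ S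
  · -- the complement inside the cycle is a non-empty even subset of the forest `D`
    have hfS : f ∉ S := fun h => (mem_erase.1 (hS h)).1 rfl
    have hS' : (insert e₀ D) ∆ S = insert e₀ D \ S := symmDiff_of_ge hSC
    have hsub : insert e₀ D \ S ⊆ D := by
      intro k hk
      rw [mem_sdiff, mem_insert] at hk
      rcases hk.1 with rfl | hkD
      · exact absurd he hk.2
      · exact hkD
    have hne' : (insert e₀ D \ S).Nonempty := ⟨f, mem_sdiff.2 ⟨hf, hfS⟩⟩
    obtain ⟨w, hw⟩ := hP _ hsub hne'
    have hev' : Even (xpdeg I (insert e₀ D \ S) w) := by rw [← hS']; exact even_xpdeg_symmDiff I hev hSev w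
    rw [hw] at hev'
    exact absurd hev' (by decide)
  · -- `S ⊆ D` has a leaf
    have hSD : S ⊆ D := fun k hk => by
      rcases mem_insert.1 (hSC hk) with rfl | hkD
      · exact absurd hk he
      · exact hkD
    obtain ⟨w, hw⟩ := hP S hSD hne
    exact hno w hw

/-- **Realisation of an abstract forest-edge witness.**  Single chord `N = {e₀}`, `J₀ = D e₀ + e₀`, peelable forest, readers off the privates
of `e₀`; a base point `x` and states `(s₁, s₂)` with `s₁ s₂ = u_{e₀}(x) + 1` and `F x + s₁ ρ_{e₀} + s₂ ρ'_{e₀} = t + ([f ∈ T₁], [f ∈ T₂])` for a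
forest edge `f ∈ D e₀`: then `(J₀ − f) ∧ Γ₁ ∧ Γ₂` has an actual solution. -/
theorem exists_solution_erase (I : LocalMap 4 n m) (hI : I.IsPure xorAndPred) (hT : Typed I) {B : BridgeData n m} (hW : B.WF I)
    {e₀ : Fin m} (hN : B.N = {e₀}) (hJ : B.J₀ = insert e₀ (B.D e₀)) (hP : Peelable I (B.J₀ \ B.N)) (h₁ : AvoidsPrivs I B.G₁ e₀)
    (h₂ : AvoidsPrivs I B.G₂ e₀) {f : Fin m} (hf : f ∈ B.D e₀) (x : Fin n → ZMod 2) (s₁ s₂ : ZMod 2)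
    (hs : s₁ * s₂ = (sys I B).u e₀ x + 1)
    (hval : (sys I B).F x + (s₁ • (sys I B).ρ e₀ x + s₂ • (sys I B).ρ' e₀ x) =
      (sys I B).t + ((if f ∈ B.T₁ then 1 else 0, if f ∈ B.T₂ then 1 else 0) : V2)) :
    ∃ z, Solution I B (B.J₀.erase f) z := by
  classical
  have he₀ : e₀ ∈ B.N := by rw [hN]; exact mem_singleton_self _
  have he₀D : e₀ ∉ B.D e₀ := fun h => (mem_sdiff.1 (hW.hD e₀ he₀ h)).2 he₀
  have h23 : I.vars e₀ 2 ≠ I.vars e₀ 3 := fun h => absurd (hI.2 e₀ h) (by decide)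
  set B' := exchange B f e₀ with hB'
  have hW' : B'.WF I := exchange_wf I hI hW he₀ hf
  -- the exchanged data: no chord, forest `(D e₀ + e₀) − f`
  have hN' : B'.N = ∅ := by
    show B.N.erase e₀ = ∅
    rw [hN, erase_singleton]
  have hF' : B'.J₀ \ B'.N = (insert e₀ (B.D e₀)).erase f := by
    rw [hN', sdiff_empty]
    show B.J₀.erase f = _
    rw [hJ]
  have hDF : B.J₀ \ B.N = B.D e₀ := by
    rw [hJ, hN, sdiff_singleton_eq_erase, erase_insert he₀D]
  have hPD : Peelable I (B.D e₀) := by rw [← hDF]; exact hP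
  have hL' : Lift I B' := by
    refine lift_of_wf_peelable I hI hT B' ?_
    rw [hF']
    exact peelable_insert_erase I hI hPD he₀D (hW.hDeven e₀ he₀) (mem_insert_of_mem hf)
  -- if there were no solution, the exchanged (chord-free) model would be infeasible: but the point below hits the target
  by_contra hno
  have hno' : ¬ ∃ z, Solution I B' B'.J₀ z := by
    rintro ⟨z, hz⟩
    exact hno ⟨z, (solution_exchange I B f e₀ _ z).1 hz⟩
  have hinf := infeasible_of_not_solution I hI hT hW' hL' hno'
  -- the base point: `x` with the privates of `e₀` set to the states
  let x' : Fin n → ZMod 2 := Function.update (Function.update x (I.vars e₀ 2) s₁) (I.vars e₀ 3) s₂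
  have hx'2 : x' (I.vars e₀ 2) = s₁ := by
    show Function.update (Function.update x (I.vars e₀ 2) s₁) (I.vars e₀ 3) s₂ (I.vars e₀ 2) = s₁
    rw [Function.update_of_ne h23, Function.update_self]
  have hx'3 : x' (I.vars e₀ 3) = s₂ := by
    show Function.update (Function.update x (I.vars e₀ 2) s₁) (I.vars e₀ 3) s₂ (I.vars e₀ 3) = s₂
    rw [Function.update_self]
  have hagree : ∀ v, v ∉ xverts I (B.J₀ \ B.N) → v ∉ privs I B.N → x v = x' v := by
    intro v _ hvp
    have hv2 : v ≠ I.vars e₀ 2 := fun h => hvp (h ▸ vars_mem_privs I he₀ (s := 2) (by decide))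
    have hv3 : v ≠ I.vars e₀ 3 := fun h => hvp (h ▸ vars_mem_privs I he₀ (s := 3) (by decide))
    show x v = Function.update (Function.update x (I.vars e₀ 2) s₁) (I.vars e₀ 3) s₂ v
    rw [Function.update_of_ne hv3, Function.update_of_ne hv2]
  have hFx : (sys I B).F x' = (sys I B).F x := by
    rw [sys_F, sys_F, free_congr I hT hW hW.hT₁ B.C₁ B.G₁ hagree, free_congr I hT hW hW.hT₂ B.C₂ B.G₂ hagree]
  have hux : (sys I B).u e₀ x' = (sys I B).u e₀ x := by rw [sys_u, sys_u]; exact (uval_congr I hT hW he₀ hagree).symm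
  obtain ⟨hρ, hρ'⟩ := reads_of_avoids I he₀ h₁ h₂ x
  -- the state-free parts of the exchanged model at `x'`
  have hfree : ∀ (T : Finset (Fin m)) (C : Finset (Fin n)) (G : Finset (Fin m)), AvoidsPrivs I G e₀ →
      free I B.y (B'.J₀ \ B'.N) (B.N.erase e₀) (if f ∈ T then T ∆ insert e₀ (B.D e₀) else T) C G x' =
        free I B.y (B.J₀ \ B.N) B.N T C G x' + (if f ∈ T then (sys I B).u e₀ x' + x' (I.vars e₀ 2) * x' (I.vars e₀ 3) else 0) +
          (if I.vars e₀ 2 ∈ C then x' (I.vars e₀ 2) else 0) + (if I.vars e₀ 3 ∈ C then x' (I.vars e₀ 3) else 0) :=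
    fun T C G hG => free_exchange I hI hT hW he₀ hf C hG x'
  have hval' : (sys I B').val B'.N x' (fun _ => (0, 0)) = (sys I B').t := by
    rw [hN']
    unfold ChordSystem.val
    rw [sum_empty, add_zero]
    show ((free I B.y (B'.J₀ \ B'.N) (B.N.erase e₀) (if f ∈ B.T₁ then B.T₁ ∆ insert e₀ (B.D e₀) else B.T₁) B.C₁ B.G₁ x',
        free I B.y (B'.J₀ \ B'.N) (B.N.erase e₀) (if f ∈ B.T₂ then B.T₂ ∆ insert e₀ (B.D e₀) else B.T₂) B.C₂ B.G₂ x') : V2) =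
      (bit B.b₁, bit B.b₂)
    rw [hfree B.T₁ B.C₁ B.G₁ h₁, hfree B.T₂ B.C₂ B.G₂ h₂, hx'2, hx'3, hux]
    -- compare with the abstract witness equation
    have hF₁ : free I B.y (B.J₀ \ B.N) B.N B.T₁ B.C₁ B.G₁ x' = ((sys I B).F x).1 := by rw [← hFx, sys_F]
    have hF₂ : free I B.y (B.J₀ \ B.N) B.N B.T₂ B.C₂ B.G₂ x' = ((sys I B).F x).2 := by rw [← hFx, sys_F]
    have ht : (sys I B).t = (bit B.b₁, bit B.b₂) := rfl
    rw [hρ, hρ', ht] at hval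
    have hv₁ := congrArg Prod.fst hval
    have hv₂ := congrArg Prod.snd hval
    simp only [Prod.fst_add, Prod.snd_add, Prod.smul_fst, Prod.smul_snd, smul_eq_mul] at hv₁ hv₂
    have hprod : (sys I B).u e₀ x + s₁ * s₂ = 1 := by
      rw [hs]; generalize (sys I B).u e₀ x = a; revert a; decide
    refine Prod.ext ?_ ?_
    · simp only
      rw [hF₁]
      by_cases hT₁ : f ∈ B.T₁
      · rw [if_pos hT₁, hprod]; rw [if_pos hT₁] at hv₁
        have key : ∀ F c₂ c₃ b t₁ t₂ : ZMod 2, F + (t₁ * c₂ + t₂ * c₃) = b + 1 → F + 1 + t₁ * c₂ + t₂ * c₃ = b := by decide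
        have := key ((sys I B).F x).1 (if I.vars e₀ 2 ∈ B.C₁ then 1 else 0) (if I.vars e₀ 3 ∈ B.C₁ then 1 else 0) (bit B.b₁) s₁ s₂ hv₁
        simpa [mul_comm] using this
      · rw [if_neg hT₁, add_zero]; rw [if_neg hT₁] at hv₁
        have key : ∀ F c₂ c₃ b t₁ t₂ : ZMod 2, F + (t₁ * c₂ + t₂ * c₃) = b + 0 → F + t₁ * c₂ + t₂ * c₃ = b := by decide
        have := key ((sys I B).F x).1 (if I.vars e₀ 2 ∈ B.C₁ then 1 else 0) (if I.vars e₀ 3 ∈ B.C₁ then 1 else 0) (bit B.b₁) s₁ s₂ hv₁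
        simpa [mul_comm] using this
    · simp only
      rw [hF₂]
      by_cases hT₂ : f ∈ B.T₂
      · rw [if_pos hT₂, hprod]; rw [if_pos hT₂] at hv₂
        have key : ∀ F c₂ c₃ b t₁ t₂ : ZMod 2, F + (t₁ * c₂ + t₂ * c₃) = b + 1 → F + 1 + t₁ * c₂ + t₂ * c₃ = b := by decide
        have := key ((sys I B).F x).2 (if I.vars e₀ 2 ∈ B.C₂ then 1 else 0) (if I.vars e₀ 3 ∈ B.C₂ then 1 else 0) (bit B.b₂) s₁ s₂ hv₂
        simpa [mul_comm] using this
      · rw [if_neg hT₂, add_zero]; rw [if_neg hT₂] at hv₂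
        have key : ∀ F c₂ c₃ b t₁ t₂ : ZMod 2, F + (t₁ * c₂ + t₂ * c₃) = b + 0 → F + t₁ * c₂ + t₂ * c₃ = b := by decide
        have := key ((sys I B).F x).2 (if I.vars e₀ 2 ∈ B.C₂ then 1 else 0) (if I.vars e₀ 3 ∈ B.C₂ then 1 else 0) (bit B.b₂) s₁ s₂ hv₂
        simpa [mul_comm] using this
  exact hinf x' (fun _ => (0, 0)) (by rw [hN']; intro e he; exact absurd he (notMem_empty e)) hval'

/-! ## The prescribed product takes both values -/

/-- **A chord is killable somewhere and forced somewhere**: `u_{e₀}` takes both values (flip the AND pair of one forest edge of `D e₀`). -/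
theorem uval_takes_both (I : LocalMap 4 n m) (hI : I.IsPure xorAndPred) (hS : SimpleOverlap I) (y : Fin m → Bool) {D : Finset (Fin m)}
    (hD : D.Nonempty) (e : Fin m) : (∃ x, uval I y D e x = 0) ∧ ∃ x, uval I y D e x = 1 := by
  classical
  obtain ⟨j₀, hj₀⟩ := hD
  let x₁ : Fin n → ZMod 2 := fun v => if v = I.vars j₀ 2 ∨ v = I.vars j₀ 3 then 1 else 0
  have hflip : uval I y D e x₁ = uval I y D e 0 + 1 := by
    have hj₀v : x₁ (I.vars j₀ 2) * x₁ (I.vars j₀ 3) = 1 := by simp [x₁]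
    have hrest : ∀ j ∈ D.erase j₀, x₁ (I.vars j 2) * x₁ (I.vars j 3) = 0 := by
      intro j hj
      have hne : j ≠ j₀ := ne_of_mem_erase hj
      by_contra hne0
      -- both AND variables of `j` lie in the AND pair of `j₀`: two shared variables
      have h2 : I.vars j 2 = I.vars j₀ 2 ∨ I.vars j 2 = I.vars j₀ 3 := by
        by_contra h; push Not at h
        apply hne0; simp [x₁, h.1, h.2]
      have h3 : I.vars j 3 = I.vars j₀ 2 ∨ I.vars j 3 = I.vars j₀ 3 := by
        by_contra h; push Not at h
        apply hne0; simp [x₁, h.1, h.2]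
      have hj23 : I.vars j 2 ≠ I.vars j 3 := fun h => absurd (hI.2 j h) (by decide)
      have hsub : ({I.vars j 2, I.vars j 3} : Finset (Fin n)) ⊆ varSet I j ∩ varSet I j₀ := by
        intro v hv
        rw [mem_insert, mem_singleton] at hv
        rw [mem_inter]
        rcases hv with rfl | rfl
        · refine ⟨vars_mem_varSet I j 2, ?_⟩
          rcases h2 with h | h <;> rw [h] <;> exact vars_mem_varSet I j₀ _
        · refine ⟨vars_mem_varSet I j 3, ?_⟩
          rcases h3 with h | h <;> rw [h] <;> exact vars_mem_varSet I j₀ _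
      have := (card_le_card hsub).trans (hS j j₀ hne)
      rw [card_pair hj23] at this
      omega
    have h0 : ∑ j ∈ D, (bit (y j) + (0 : Fin n → ZMod 2) (I.vars j 2) * (0 : Fin n → ZMod 2) (I.vars j 3)) = ∑ j ∈ D, bit (y j) :=
      sum_congr rfl fun j _ => by simp
    have h1 : ∑ j ∈ D, (bit (y j) + x₁ (I.vars j 2) * x₁ (I.vars j 3)) = ∑ j ∈ D, bit (y j) + 1 := by
      rw [sum_add_distrib, ← add_sum_erase D (fun j => x₁ (I.vars j 2) * x₁ (I.vars j 3)) hj₀, hj₀v,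
        sum_congr rfl fun j hj => hrest j hj, sum_const_zero, add_zero]
    unfold uval
    rw [h0, h1, add_assoc]
  rcases zmod2_cases (uval I y D e 0) with h0 | h1
  · exact ⟨⟨0, h0⟩, ⟨x₁, by rw [hflip, h0, zero_add]⟩⟩
  · exact ⟨⟨x₁, by rw [hflip, h1]; decide⟩, ⟨0, h1⟩⟩

end Summit.PneNP.PneNP.Theorems.PstarFreshGateRealise
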